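import Literature.NumberTheory.EllipticCurves.ComplexMultiplicationDeuringReductionProofs
import Literature.NumberTheory.EllipticCurves.CMAnalyticDegreeProofs
import Literature.NumberTheory.EllipticCurves.CMEndomorphismOfCertificate
import Literature.NumberTheory.EllipticCurves.CMTransformationCertificates
import Literature.NumberTheory.EllipticCurves.GeomEndRingTransport
import Literature.NumberTheory.EllipticCurves.ComplexMultiplicationSingularModuliProofs
import HarnessLib

/-!
# `End_{ℚ̄}(E) ≅ 𝓞_K = ℤ[ω_d]` with `deg = N`: discharge of `Cox2013_exists_ringEquiv_cmRing_geomEndRing`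

Topic `NumberTheory/EllipticCurves`; a proofs-only sibling (D-0014 append protocol: theorems only,
no definitions, no named facts) of `ComplexMultiplicationDeuringReductionProofs.lean`, which
isolated, as the named fact (C) `Cox2013_exists_ringEquiv_cmRing_geomEndRing` of its decomposition
of Deuring's reduction isomorphism, the statement: *for an elliptic curve `E/ℚ` given by `W` with
`j(W) ∈ maximalCMJInvariants`, `d = cmDiscr (j W)`, there is a ring isomorphism
`ι₀ : ℤ[ω_d] = cmRing d ≃+* End_{ℚ̄}(E) = W.geomEndRing` under which `#ker (ι₀ α) = N(α) = α ᾱ`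
(`α ≠ 0`)* — Cox, *Primes of the form x² + ny²*, §14.B (PDF pp. 318–319: `End_ℂ(E) = {α : αL ⊂ L}`
is the order `𝓞`; `deg(α) = |L/αL| = N(α)`), Prop. 14.9 (`℘(αz) = R(℘ z)`), Thm. 10.14 and
Cor. 10.20, the table (12.20) of §12.C; Silverman, *Advanced Topics*, Prop. II.1.1, Cor. II.1.5(b),
Thm. II.2.2(c), App. A §3.  **This file proves it** (`Cox2013_exists_ringEquiv_cmRing_geomEndRing_holds`).

## The proof

For each of the nine discriminants `d` a short model `E_d : y² = x³ − (A/4)x − B/4` over `ℚ`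
with integer invariants `(g₂, g₃) = (A, B)` and `j(E_d) = j_d` is fixed (the invariants of the
kernel-checked transformation certificates `CMCert.check` of `CMTransformationCertificates.lean`,
`SingularModuliCertificates.lean`).  By the CM-period theorem of the tree
(`exists_isCMPeriod_of_j_mem_maximalCMJInvariants_holds`: uniformization, `h(d) = 1` by reduction
theory, and the nine singular moduli) `E_d` has a period lattice `Λ = Ω · ℤ[ω_d]` with
`E_d ⊗ ℂ = E_Λ`.  Along an embedding `σ : ℚ̄ → ℂ` the analytic representation
`ρ : End_{ℚ̄}(E_d) →+* ℂ` (`CMAnalyticRepresentation.lean`, Silverman *AEC* VI.5.3) is injective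
with image in `End(Λ) = ℤ[ω_d]`; the certificate of complex multiplication by the generator
`w = ω_d + k` of `ℤ[ω_d]` produces `φ ∈ End_{ℚ̄}(E_d)` with `ρ(φ) = w`
(`CMEndomorphismOfCertificate.lean`, Cox Prop. 14.9), so `ρ` is onto `ℤ[ω_d]`; the degree formula
`#ker φ = ρ(φ)·conj ρ(φ)` is `CMAnalyticDegreeProofs.lean` (Cox §14.B, `deg = |L/αL| = N`).  Finally
any `W` with `j(W) = j_d` is `ℚ̄`-isomorphic to `E_d` (Silverman *AEC* III.1.4(b)) and the
isomorphism transports `End_{ℚ̄}` with its kernel cardinalities (`GeomEndRingTransport.lean`).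

* `CMCert.natDegree_toPoly_lt` — the degree condition `deg Q < deg P` read off the coefficient
  lists;
* `exists_ringEquiv_cmRing_geomEndRing_of_check` — the model case, uniformly in the certificate;
* `exists_ringEquiv_cmRing_geomEndRing_of_j_eq` — the nine models, by `j`-invariant;
* `Cox2013_exists_ringEquiv_cmRing_geomEndRing_holds` — **the discharge**; whence
  `Deuring1941_exists_ringEquiv_cmRing_geomEndRing_of_three_facts`,
  `Deuring1941_frobeniusTrace_eq_add_conj_of_three_facts` (the parent assemblies with (C) fed in).

## References

* [Cox2013] D. A. Cox, *Primes of the form x² + ny²*, 2nd ed., Wiley (2013): §14.B and Prop. 14.9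
  (PDF pp. 318–319), Thm. 10.14, Cor. 10.20, §12.C table (12.20). Held:
  `book:cox2013-primes-form-i-x-sup-2-sup`.
* [SilvermanAdvancedTopics1994] J. H. Silverman, *Advanced Topics in the Arithmetic of Elliptic
  Curves*, GTM 151 (1994): Prop. II.1.1, Cor. II.1.5(b), Thm. II.2.2(c), App. A §3.
* [SilvermanAEC2009] J. H. Silverman, *The Arithmetic of Elliptic Curves*, 2nd ed. (2009):
  Prop. III.1.4(b), Cor. III.6.4(b), Thm. VI.4.1(b), Thm. VI.5.3.
-/

noncomputable section

open scoped Classical ComplexConjugate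

open Polynomial

namespace Literature.NumberTheory.EllipticCurves

open WeierstrassCurve PeriodPair

/-! ### The degree condition from the coefficient lists -/

namespace CMCert

/-- `deg (toPoly w p) < length p` for a nonempty coefficient list. [folklore] -/
theorem natDegree_toPoly_lt_length (w : ℂ) :
    ∀ p : Poly, p ≠ [] → (Poly.toPoly w p).natDegree < p.length
  | [], h => absurd rfl h
  | [c], _ => by simp [Poly.toPoly_cons]
  | c :: c' :: p, _ => by
    have ih := natDegree_toPoly_lt_length w (c' :: p) (List.cons_ne_nil _ _)
    rw [Poly.toPoly_cons, List.length_cons]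
    refine (natDegree_add_le _ _).trans_lt (max_lt ?_ ?_)
    · rw [natDegree_C]; exact Nat.succ_pos _
    · refine natDegree_mul_le.trans_lt ?_
      have hX : (X : ℂ[X]).natDegree ≤ 1 := natDegree_X_le
      omega

/-- The coefficient of `X^(length p)` in `toPoly w (p ++ [c])` is the denotation of `c`.
[folklore] -/
theorem coeff_toPoly_append_singleton (w : ℂ) (c : ZW) :
    ∀ p : Poly, (Poly.toPoly w (p ++ [c])).coeff p.length = ZW.toC w c
  | [] => by simp [Poly.toPoly_cons]
  | c₀ :: p => by
    rw [List.cons_append, Poly.toPoly_cons, List.length_cons, coeff_add, coeff_C_succ, coeff_X_mul,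
      zero_add]
    exact coeff_toPoly_append_singleton w c p

/-- **The degree condition `deg Q < deg P` from the lists**: if `Q` is a nonempty list shorter
than `P` and the last entry of `P` is nonzero (so nonzero at any `w ∉ ℝ`), then
`deg (toPoly w Q) < deg (toPoly w P)`. [folklore] -/
theorem natDegree_toPoly_lt {w : ℂ} (hw : w.im ≠ 0) {P Q : Poly} (hlen : Q.length < P.length)
    (hQ : Q ≠ []) (hlast : P.getLast? ≠ some ZW.zero) :
    (Poly.toPoly w Q).natDegree < (Poly.toPoly w P).natDegree := by
  have hP : P ≠ [] := by rintro rfl; simp at hlen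
  set c : ZW := P.getLast hP with hc
  have hc0 : c ≠ ZW.zero := fun h ↦ hlast (by rw [List.getLast?_eq_getLast_of_ne_nil hP, ← hc, h])
  have hPeq : P.dropLast ++ [c] = P := List.dropLast_append_getLast hP
  have hcoeff : (Poly.toPoly w P).coeff P.dropLast.length ≠ 0 := by
    have h := coeff_toPoly_append_singleton w c P.dropLast
    rw [hPeq] at h
    rw [h]
    exact fun h0 ↦ hc0 (ZW.eq_zero_of_toC_eq_zero hw h0)
  have h1 : P.dropLast.length ≤ (Poly.toPoly w P).natDegree := le_natDegree_of_ne_zero hcoeff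
  have h2 : (Poly.toPoly w Q).natDegree < Q.length := natDegree_toPoly_lt_length w Q hQ
  rw [List.length_dropLast] at h1
  omega

end CMCert

/-! ### The model case -/

/-- **`End_{ℚ̄}(E) ≅ ℤ[ω_d]` with `#ker = N` for a certified CM model** (Cox, *Primes of the form
x² + ny²*, §14.B and Prop. 14.9; Silverman, *Advanced Topics*, Prop. II.1.1, Cor. II.1.5(b),
Thm. II.2.2(c)).  Let `d ∈ cmDiscrs` and let `E : y² = x³ − (A/4)x − B/4` over `ℚ` be elliptic
with `cmDiscr (j E) = d`, `j E ∈ maximalCMJInvariants`; suppose coefficient lists `P, Q` pass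
`CMCert.check t n A B w P Q` for the multiplier `w = ω_d + k` (`w² = tw − n`), with `Q` nonempty,
shorter than `P`, and `P` of nonzero top entry.  Then there is a ring isomorphism
`ι : cmRing d ≃+* E.geomEndRing` with `#ker (ι α) = α ᾱ` for `α ≠ 0`.  (Period lattice
`Λ = Ω ℤ[ω_d]` with `E ⊗ ℂ = E_Λ`; the analytic representation `ρ` is injective into
`End(Λ) = ℤ[ω_d]` and hits `w`, hence is onto; `ι = ρ⁻¹`; degrees by `#ker φ = ρ(φ) conj ρ(φ)`.)
[cite: Cox2013, §14.B and Prop. 14.9 (PDF pp. 318–319)]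
[cite: SilvermanAdvancedTopics1994, Prop. II.1.1 and Cor. II.1.5(b)] -/
theorem exists_ringEquiv_cmRing_geomEndRing_of_check {d t n A B k : ℤ} {P Q : CMCert.Poly}
    (hd : d ∈ cmDiscrs) (hcheck : CMCert.check t n A B ⟨0, 1⟩ P Q = true)
    (hw : (cmGen d + k) ^ 2 = t * (cmGen d + k) - n)
    (hlen : Q.length < P.length) (hQ : Q ≠ []) (hlast : P.getLast? ≠ some CMCert.ZW.zero)
    (E : WeierstrassCurve ℚ) [E.IsElliptic] (hEq : E = ⟨0, 0, 0, -(A : ℚ) / 4, -(B : ℚ) / 4⟩)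
    (hj : E.j ∈ maximalCMJInvariants) (hjd : cmDiscr E.j = d) :
    ∃ ι : cmRing d ≃+* E.geomEndRing, ∀ α : cmRing d, α ≠ 0 →
      ((Nat.card (AddMonoidHom.ker ((ι α : AddMonoid.End E.geomPoints) :
          E.geomPoints →+ E.geomPoints)) : ℕ) : ℂ) = (α : ℂ) * conj (α : ℂ) := by
  obtain ⟨hdneg, c, hc⟩ := neg_and_exists_of_mem_cmDiscrs hd
  set w : ℂ := cmGen d + k with hwdef
  have hwim : w.im ≠ 0 := by
    rw [hwdef, Complex.add_im, Complex.intCast_im, add_zero]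
    exact (cmGen_im_pos hdneg).ne'
  have hw0 : w ≠ 0 := fun h ↦ hwim (by rw [h, Complex.zero_im])
  -- the period lattice `Λ = Ω ℤ[ω_d]`, `E ⊗ ℂ = E_Λ`
  obtain ⟨Ω, L, hL, hΛ⟩ := exists_isCMPeriod_of_j_mem_maximalCMJInvariants_holds E hj
  rw [hjd] at hΛ
  have hc₄ : E.c₄ = 12 * A := by
    rw [hEq]
    simp only [WeierstrassCurve.c₄, WeierstrassCurve.b₂, WeierstrassCurve.b₄]
    ring
  have hc₆ : E.c₆ = 216 * B := by
    rw [hEq]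
    simp only [WeierstrassCurve.c₆, WeierstrassCurve.b₂, WeierstrassCurve.b₄, WeierstrassCurve.b₆]
    ring
  have hg₂ : L.g₂ = A := by
    rw [hL.1]
    simp only [WeierstrassCurve.baseChange, WeierstrassCurve.map_c₄, hc₄, eq_ratCast]
    push_cast
    ring
  have hg₃ : L.g₃ = B := by
    rw [hL.2]
    simp only [WeierstrassCurve.baseChange, WeierstrassCurve.map_c₆, hc₆, eq_ratCast]
    push_cast
    ring
  have hE : E.baseChange ℂ = L.curve := by
    rw [PeriodPair.curve, hg₂, hg₃, hEq]
    ext <;> simp [WeierstrassCurve.baseChange]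
  -- `Ω ≠ 0`, `Ω ∈ Λ`
  have hmemΛ : ∀ x : ℂ, x ∈ L.lattice ↔ ∃ s ∈ cmRing d, Ω * s = x := by
    intro x
    have := Set.ext_iff.1 hΛ x
    simpa only [SetLike.mem_coe, Set.mem_image] using this
  have hΩΛ : Ω ∈ L.lattice := (hmemΛ Ω).2 ⟨1, one_mem _, mul_one Ω⟩
  have hΩ0 : Ω ≠ 0 := by
    intro h0
    obtain ⟨s, -, hs⟩ := (hmemΛ L.ω₁).1 L.ω₁_mem_lattice
    rw [h0, zero_mul] at hs
    exact L.ω₁_div_two_notMem_lattice (by rw [← hs, zero_div]; exact zero_mem _)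
  -- an embedding `σ : ℚ̄ → ℂ` and the analytic representation `ρ`
  set σ : AlgebraicClosure ℚ →ₐ[ℚ] ℂ :=
    (@IsAlgClosed.lift ℂ _ _ ℚ _ _ (AlgebraicClosure ℚ) _ _ (AlgebraicClosure.instAlgebra ℚ) _ _ _
      (AlgebraicClosure.isAlgebraic ℚ)) with hσ
  set ρ : E.geomEndRing →+* ℂ := analyticReprHom hE σ with hρ
  -- `ρ` lands in `ℤ[ω_d]`
  have hρmem : ∀ φ : E.geomEndRing, ρ φ ∈ cmRing d := by
    intro φ
    have h1 : ρ φ * Ω ∈ L.lattice := analyticRepr_mul_mem_lattice hE σ φ hΩΛ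
    obtain ⟨s, hs, hsx⟩ := (hmemΛ _).1 h1
    have : ρ φ = s := mul_left_cancel₀ hΩ0 (by rw [hsx, mul_comm])
    rw [this]; exact hs
  -- the certificate gives `φ₀` with `ρ φ₀ = w`, so `ρ` is onto `ℤ[ω_d]`
  have hcert : CMCert.IsCMCertificate L.g₂ L.g₃ w (CMCert.Poly.toPoly w P) (CMCert.Poly.toPoly w Q) := by
    have h := CMCert.check_sound hw hwim hcheck
    have hα : CMCert.ZW.toC w ⟨0, 1⟩ = w := by simp [CMCert.ZW.toC_mk]
    rwa [hα, ← hg₂, ← hg₃] at h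
  have hwr : w ∈ Set.range σ := by
    obtain ⟨r, hr⟩ := exists_eq_of_sq_eq σ hw
    exact ⟨r, hr⟩
  obtain ⟨φ₀, hφ₀⟩ := exists_geomEndRing_analyticRepr_eq_of_mem_lifts hE σ hcert
    (CMCert.natDegree_toPoly_lt hwim hlen hQ hlast) hw0 hwr (CMCert.toPoly_mem_lifts σ hwr P)
    (CMCert.toPoly_mem_lifts σ hwr Q)
  have hsurj : ∀ s ∈ cmRing d, ∃ φ : E.geomEndRing, ρ φ = s := by
    have hgen : cmGen d ∈ ρ.range := by
      refine ⟨φ₀ - (k : E.geomEndRing), ?_⟩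
      rw [map_sub, map_intCast, hρ, analyticReprHom_apply, hφ₀, hwdef, add_sub_cancel_right]
    have hle : cmRing d ≤ ρ.range := by
      rw [cmRing]
      exact Subring.closure_le.2 (Set.singleton_subset_iff.2 hgen)
    intro s hs
    obtain ⟨φ, hφ⟩ := hle hs
    exact ⟨φ, hφ⟩
  -- `ι = ρ⁻¹ : ℤ[ω_d] ≃ End_{ℚ̄}(E)`
  set ρ' : E.geomEndRing →+* cmRing d := ρ.codRestrict (cmRing d) hρmem with hρ'
  have hρ'bij : Function.Bijective ρ' := by
    refine ⟨fun φ ψ h ↦ analyticReprHom_injective hE σ (congrArg Subtype.val h : _), fun s ↦ ?_⟩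
    obtain ⟨φ, hφ⟩ := hsurj s s.2
    exact ⟨φ, Subtype.ext hφ⟩
  set ι : cmRing d ≃+* E.geomEndRing := (RingEquiv.ofBijective ρ' hρ'bij).symm with hι
  refine ⟨ι, fun α hα ↦ ?_⟩
  have hρι : analyticRepr hE σ (ι α) = α := by
    have h1 : ρ' (ι α) = α := by
      rw [hι, ← RingEquiv.ofBijective_apply ρ' hρ'bij, RingEquiv.apply_symm_apply]
    exact congrArg Subtype.val h1
  have hα0 : analyticRepr hE σ (ι α) ≠ 0 := by
    rw [hρι]; exact fun h ↦ hα (Subtype.ext h)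
  rw [natCard_ker_eq_analyticRepr_mul_conj hE σ (ι α) hα0, hρι]

/-! ### The nine models -/

/-- **The nine certified CM models**: for every `j₀ ∈ maximalCMJInvariants` there is an elliptic
curve `E/ℚ` with `j(E) = j₀` and a ring isomorphism `ι : ℤ[ω_d] ≃+* End_{ℚ̄}(E)`,
`d = cmDiscr j₀`, with `#ker (ι α) = α ᾱ` (`α ≠ 0`) — the models `y² = x³ − (A/4)x − B/4` of the
transformation certificates `CMCert.check3`, `check4`, `check7`, `check8`, `check11`, `check19`
(`CMTransformationCertificates.lean`), `check43`, `check67`, `check163`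
(`SingularModuliCertificates.lean`). Cox, *Primes of the form x² + ny²*, §14.B with the table
(12.20) of §12.C; Silverman, *Advanced Topics*, App. A §3.
[cite: Cox2013, §14.B (PDF pp. 318–319) and §12.C table (12.20)] -/
theorem exists_ringEquiv_cmRing_geomEndRing_of_j_eq {j₀ : ℚ} (hj₀ : j₀ ∈ maximalCMJInvariants) :
    ∃ (E : WeierstrassCurve ℚ) (_ : E.IsElliptic), E.j = j₀ ∧
      ∃ ι : cmRing (cmDiscr j₀) ≃+* E.geomEndRing, ∀ α : cmRing (cmDiscr j₀), α ≠ 0 →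
        ((Nat.card (AddMonoidHom.ker ((ι α : AddMonoid.End E.geomPoints) :
            E.geomPoints →+ E.geomPoints)) : ℕ) : ℂ) = (α : ℂ) * conj (α : ℂ) := by
  -- the generic model and its invariants
  have hmodel : ∀ (A B : ℤ), ((A : ℚ) ^ 3 - 27 * (B : ℚ) ^ 2 ≠ 0) →
      ∃ _ : (⟨0, 0, 0, -(A : ℚ) / 4, -(B : ℚ) / 4⟩ : WeierstrassCurve ℚ).IsElliptic,
        (⟨0, 0, 0, -(A : ℚ) / 4, -(B : ℚ) / 4⟩ : WeierstrassCurve ℚ).j =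
          1728 * (A : ℚ) ^ 3 / ((A : ℚ) ^ 3 - 27 * (B : ℚ) ^ 2) := by
    intro A B hΔ
    set E : WeierstrassCurve ℚ := ⟨0, 0, 0, -(A : ℚ) / 4, -(B : ℚ) / 4⟩ with hEdef
    have hΔE : E.Δ = (A : ℚ) ^ 3 - 27 * (B : ℚ) ^ 2 := by
      simp only [hEdef, WeierstrassCurve.Δ, WeierstrassCurve.b₂, WeierstrassCurve.b₄,
        WeierstrassCurve.b₆, WeierstrassCurve.b₈]
      ring
    have hc₄E : E.c₄ = 12 * A := by
      simp only [hEdef, WeierstrassCurve.c₄, WeierstrassCurve.b₂, WeierstrassCurve.b₄]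
      ring
    haveI hell : E.IsElliptic := by
      rw [WeierstrassCurve.isElliptic_iff, hΔE]; exact hΔ.isUnit
    refine ⟨hell, ?_⟩
    rw [WeierstrassCurve.j, Units.val_inv_eq_inv_val, WeierstrassCurve.coe_Δ', hΔE, hc₄E]
    field_simp
    ring
  have key : ∀ {d t n A B k : ℤ} {P Q : CMCert.Poly}, d ∈ cmDiscrs →
      CMCert.check t n A B ⟨0, 1⟩ P Q = true → (cmGen d + k) ^ 2 = t * (cmGen d + k) - n →
      Q.length < P.length → Q ≠ [] → P.getLast? ≠ some CMCert.ZW.zero →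
      ((A : ℚ) ^ 3 - 27 * (B : ℚ) ^ 2 ≠ 0) →
      1728 * (A : ℚ) ^ 3 / ((A : ℚ) ^ 3 - 27 * (B : ℚ) ^ 2) = j₀ → cmDiscr j₀ = d →
      ∃ (E : WeierstrassCurve ℚ) (_ : E.IsElliptic), E.j = j₀ ∧
        ∃ ι : cmRing (cmDiscr j₀) ≃+* E.geomEndRing, ∀ α : cmRing (cmDiscr j₀), α ≠ 0 →
          ((Nat.card (AddMonoidHom.ker ((ι α : AddMonoid.End E.geomPoints) :
              E.geomPoints →+ E.geomPoints)) : ℕ) : ℂ) = (α : ℂ) * conj (α : ℂ) := by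
    intro d t n A B k P Q hd hcheck hw hlen hQ hlast hΔ hjAB hjd
    obtain ⟨hell, hjE⟩ := hmodel A B hΔ
    have hjE' : (⟨0, 0, 0, -(A : ℚ) / 4, -(B : ℚ) / 4⟩ : WeierstrassCurve ℚ).j = j₀ := hjE.trans hjAB
    subst hjd
    have hjm : (⟨0, 0, 0, -(A : ℚ) / 4, -(B : ℚ) / 4⟩ : WeierstrassCurve ℚ).j ∈ maximalCMJInvariants := by
      rw [hjE']; exact hj₀
    exact ⟨_, hell, hjE', exists_ringEquiv_cmRing_geomEndRing_of_check hd hcheck hw hlen hQ hlast _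
      rfl hjm (by rw [hjE'])⟩
  -- the nine cases
  simp only [maximalCMJInvariants, Finset.mem_insert, Finset.mem_singleton] at hj₀
  rcases hj₀ with rfl | rfl | rfl | rfl | rfl | rfl | rfl | rfl | rfl
  · -- `j = 0`, `d = -3`, `w = ω + 2 = (1 + √-3)/2`, `w² = w - 1`
    exact key (d := -3) (k := 2) (by decide) CMCert.check3
      (by have e := cmGen_sq (d := -3) (c := 3) (by norm_num) (by norm_num); push_cast at e ⊢; linear_combination e)
      (by decide) (by decide) (by decide) (by norm_num) (by norm_num) (by norm_num [cmDiscr])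
  · -- `j = 1728`, `d = -4`, `w = ω + 2 = i`, `w² = -1`
    exact key (d := -4) (k := 2) (by decide) CMCert.check4
      (by have e := cmGen_sq (d := -4) (c := 5) (by norm_num) (by norm_num); push_cast at e ⊢; linear_combination e)
      (by decide) (by decide) (by decide) (by norm_num) (by norm_num) (by norm_num [cmDiscr])
  · -- `j = -3375`, `d = -7`, `w = ω + 4`, `w² = w - 2`
    exact key (d := -7) (k := 4) (by decide) CMCert.check7
      (by have e := cmGen_sq (d := -7) (c := 14) (by norm_num) (by norm_num); push_cast at e ⊢; linear_combination e)
      (by decide) (by decide) (by decide) (by norm_num) (by norm_num) (by norm_num [cmDiscr])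
  · -- `j = 8000`, `d = -8`, `w = ω + 4 = √-2`, `w² = -2`
    exact key (d := -8) (k := 4) (by decide) CMCert.check8
      (by have e := cmGen_sq (d := -8) (c := 18) (by norm_num) (by norm_num); push_cast at e ⊢; linear_combination e)
      (by decide) (by decide) (by decide) (by norm_num) (by norm_num) (by norm_num [cmDiscr])
  · -- `j = -32768`, `d = -11`, `w = ω + 6`, `w² = w - 3`
    exact key (d := -11) (k := 6) (by decide) CMCert.check11
      (by have e := cmGen_sq (d := -11) (c := 33) (by norm_num) (by norm_num); push_cast at e ⊢; linear_combination e)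
      (by decide) (by decide) (by decide) (by norm_num) (by norm_num) (by norm_num [cmDiscr])
  · -- `j = -884736`, `d = -19`, `w = ω + 10`, `w² = w - 5`
    exact key (d := -19) (k := 10) (by decide) CMCert.check19
      (by have e := cmGen_sq (d := -19) (c := 95) (by norm_num) (by norm_num); push_cast at e ⊢; linear_combination e)
      (by decide) (by decide) (by decide) (by norm_num) (by norm_num) (by norm_num [cmDiscr])
  · -- `j = -884736000`, `d = -43`, `w = ω + 22`, `w² = w - 11`
    exact key (d := -43) (k := 22) (by decide) CMCert.check43
      (by have e := cmGen_sq (d := -43) (c := 473) (by norm_num) (by norm_num); push_cast at e ⊢; linear_combination e)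
      (by decide) (by decide) (by decide) (by norm_num) (by norm_num) (by norm_num [cmDiscr])
  · -- `j = -147197952000`, `d = -67`, `w = ω + 34`, `w² = w - 17`
    exact key (d := -67) (k := 34) (by decide) CMCert.check67
      (by have e := cmGen_sq (d := -67) (c := 1139) (by norm_num) (by norm_num); push_cast at e ⊢; linear_combination e)
      (by decide) (by decide) (by decide) (by norm_num) (by norm_num) (by norm_num [cmDiscr])
  · -- `j = -262537412640768000`, `d = -163`, `w = ω + 82`, `w² = w - 41`
    exact key (d := -163) (k := 82) (by decide) CMCert.check163
      (by have e := cmGen_sq (d := -163) (c := 6683) (by norm_num) (by norm_num); push_cast at e ⊢; linear_combination e)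
      (by decide) (by decide) (by decide) (by norm_num) (by norm_num) (by norm_num [cmDiscr])

/-! ### The discharge -/

/-- **Discharge of (C) `Cox2013_exists_ringEquiv_cmRing_geomEndRing`** — for an elliptic curve
`E/ℚ` given by `W` with `j(W) ∈ maximalCMJInvariants`, `d = cmDiscr (j W)`: a ring isomorphism
`ι₀ : ℤ[ω_d] ≃+* End_{ℚ̄}(E)` with `#ker (ι₀ α) = N(α) = α ᾱ` for `α ≠ 0` (Cox, *Primes of the
form x² + ny²*, §14.B, PDF pp. 318–319, with Prop. 14.9, Thm. 10.14, Cor. 10.20 and the table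
(12.20); Silverman, *Advanced Topics*, Prop. II.1.1, Cor. II.1.5(b), Thm. II.2.2(c), App. A §3).
`W` has the `j`-invariant of one of the nine certified models `E`
(`exists_ringEquiv_cmRing_geomEndRing_of_j_eq`), so `W ≅ E` over `ℚ̄` (Silverman *AEC*
III.1.4(b)) and the isomorphism transports `End_{ℚ̄}` with its kernel cardinalities
(`exists_ringEquiv_geomEndRing_of_j_eq`). [cite: Cox2013, §14.B (PDF pp. 318–319), Thm. 10.14 and Cor. 10.20]
[cite: SilvermanAdvancedTopics1994, Prop. II.1.1, Cor. II.1.5(b), Thm. II.2.2(c), App. A §3] -/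
theorem Cox2013_exists_ringEquiv_cmRing_geomEndRing_holds :
    Cox2013_exists_ringEquiv_cmRing_geomEndRing := by
  intro W _ hj
  obtain ⟨E, _, hjE, ι, hι⟩ := exists_ringEquiv_cmRing_geomEndRing_of_j_eq hj
  obtain ⟨e, he⟩ := WeierstrassCurve.exists_ringEquiv_geomEndRing_of_j_eq (V₁ := W) (V₂ := E) hjE.symm
  refine ⟨ι.trans e, fun α hα ↦ ?_⟩
  rw [RingEquiv.coe_trans, Function.comp_apply, he (ι α)]
  exact hι α hα

/-- **Deuring's reduction isomorphism from three facts** — the parent file's assembly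
`Deuring1941_exists_ringEquiv_cmRing_geomEndRing_of_facts` with (C) discharged: the trust base of
`Deuring1941_exists_ringEquiv_cmRing_geomEndRing` along this route is (R), (D1), (D2).
[cite: Lang1987, Ch. 13 §4 Thm. 12(ii) and its proof (PDF pp. 140–141)] -/
theorem Deuring1941_exists_ringEquiv_cmRing_geomEndRing_of_three_facts
    (hR : Silverman1994_exists_reduction_ringHom_geomEndRing)
    (hD1 : Deuring1941_exists_pTorsion_reduction_of_split)
    (hD2 : Lang1987_geomEndRing_isOrder_of_exists_pTorsion.{0}) :
    Deuring1941_exists_ringEquiv_cmRing_geomEndRing :=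
  Deuring1941_exists_ringEquiv_cmRing_geomEndRing_of_facts
    Cox2013_exists_ringEquiv_cmRing_geomEndRing_holds hR hD1 hD2

/-- **Cox's Theorem 14.16 (`a_p = π + π̄`) from three facts** — `Deuring1941_frobeniusTrace_eq_add_conj_of_facts`
with (C) discharged. [cite: Cox2013, Thm. 14.16 and its proof (§14.C, PDF pp. 322–323)] -/
theorem Deuring1941_frobeniusTrace_eq_add_conj_of_three_facts
    (hR : Silverman1994_exists_reduction_ringHom_geomEndRing)
    (hD1 : Deuring1941_exists_pTorsion_reduction_of_split)
    (hD2 : Lang1987_geomEndRing_isOrder_of_exists_pTorsion.{0}) :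
    Deuring1941_frobeniusTrace_eq_add_conj :=
  Deuring1941_frobeniusTrace_eq_add_conj_of_facts
    Cox2013_exists_ringEquiv_cmRing_geomEndRing_holds hR hD1 hD2

end Literature.NumberTheory.EllipticCurves

end
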